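import Mathlib
import HarnessLib
import Summits.KontsevichZagierPeriods.KontsevichZagierPeriods.Theses.IsogenyCertificates
import Literature.NumberTheory.Transcendental.KZRelationsLE
import Literature.NumberTheory.Transcendental.KZSubcalculusInvariants
import Literature.NumberTheory.Transcendental.KZKernelConjectureForms
import Summits.KontsevichZagierPeriods.KontsevichZagierPeriods.Theses.VeryGoodTransfer

/-!
# Sketch — crux XMapKernel (stmt-KontsevichZagierPeriods-10663), crux-ideate round 1, ideator 1

First lemmas of the two idea cards `axiom-saturated-sector-peeling` (Card P) and
`resolved-kernel-import` (Card I). Definitions only (no `sorry`); everything is stated over the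
tree's KZ calculus and the route decl `XMapKernel`.
-/

noncomputable section

open scoped BigOperators Classical
open Polynomial Set

namespace Summit.KontsevichZagierPeriods.KontsevichZagierPeriods.Cruxes.XMapKernel.Ideator1

open Literature.NumberTheory.Transcendental
open Summit.KontsevichZagierPeriods.KontsevichZagierPeriods.Theses.IsogenyCertificates (XMapKernel)

/-! ### The enlarged generator set of the crux, named -/

/-- The x-rational isogeny datum of the route (verbatim conjuncts of the crux). -/
def IsXDatum (A B A' B' : ℤ) (f g : ℚ[X]) (c : ℚ) : Prop :=
  derivative f * g - f * derivative g ≠ 0 ∧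
  C (c ^ 2) * g * (f ^ 3 + C (A' : ℚ) * f * g ^ 2 + C (B' : ℚ) * g ^ 3) =
    (X ^ 3 + C (A : ℚ) * X + C (B : ℚ)) * (derivative f * g - f * derivative g) ^ 2

/-- Nonsingularity of `y² = x³ + A x + B`. -/
def Nonsing (E : ℤ × ℤ) : Prop := 4 * E.1 ^ 3 + 27 * E.2 ^ 2 ≠ 0

/-- `r` is the real-period representation `[{P_E > 0}, a/√P_E]` (dimension 1). -/
def IsEllRep (E : ℤ × ℤ) (a : ℚ) (r : KZ.IntegralRep 1) : Prop :=
  r.domain = {x | 0 < x 0 ^ 3 + (E.1 : ℝ) * x 0 + (E.2 : ℝ)} ∧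
  EqOn r.integrand (fun x => (a : ℝ) / Real.sqrt (x 0 ^ 3 + (E.1 : ℝ) * x 0 + (E.2 : ℝ))) r.domain

/-- The x-map relator set of the crux (same set as in `XMapKernel`, with the conjuncts grouped). -/
def xmapRel : Set KZ.FormalRep :=
  {d | ∃ (A B A' B' : ℤ) (f g : ℚ[X]) (c a b : ℚ) (r r' : KZ.IntegralRep 1),
    Nonsing (A, B) ∧ Nonsing (A', B') ∧ IsXDatum A B A' B' f g c ∧ 0 < a ∧ 0 < b ∧
    IsEllRep (A, B) a r ∧ IsEllRep (A', B') b r' ∧ r.value = r'.value ∧ d = KZ.of r - KZ.of r'}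

/-- The five generator sets of the crux. -/
def GX : Set KZ.FormalRep :=
  KZ.domainAddRel ∪ KZ.integrandAddRel ∪ KZ.changeOfVariablesRel ∪ KZ.newtonLeibnizRel ∪ xmapRel

/-- Kernel form over the named generator set (to be identified with `XMapKernel` by unfolding;
the prover checks `GX`'s last summand against the crux's set-builder literally). -/
def XMapKernel' : Prop := ∀ c : KZ.FormalRep, KZ.eval c = 0 → c ∈ AddSubgroup.closure GX

/-! ### Card I — `resolved-kernel-import` -/

/-- Stability of the relator set under integrand scaling by a positive rational (the relator
`(a, b)` goes to `(q a, q b)`): the only input the tree's division bookkeeping needs. -/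
def XMapRelScaleStable : Prop :=
  ∀ (q : ℚ) (hq : IsAlgebraic ℚ ((q : ℚ) : ℝ)), 0 < q →
    ∀ d ∈ xmapRel, KZ.scale ((q : ℚ) : ℝ) hq d ∈ xmapRel

/-- Unique divisibility of the ENLARGED module `FormalRep ⧸ closure GX`. -/
def EnlargedUniqueDivisibility : Prop :=
  ∀ (m : ℕ) (c : KZ.FormalRep), m ≠ 0 →
    m • c ∈ AddSubgroup.closure GX → c ∈ AddSubgroup.closure GX

/-- FIRST LEMMA (Card I): scale-stability of the relators gives unique divisibility of the
enlarged module (via `KZ.scale_mem_*` for the four move sets and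
`KZ.IntegralRep.of_constMul_nat_sub_nsmul_mem`). -/
def CardI_FirstLemma : Prop := XMapRelScaleStable → EnlargedUniqueDivisibility

/-- The ℚ-coefficient kernel conjecture (= VeryGoodTransfer's `ResolvedRepsKernel` after
`RationalRepsResolve` and `KZ.exists_isRational_equivalent_holds`). -/
def RationalMultipleKernel : Prop :=
  ∀ c : KZ.FormalRep, KZ.eval c = 0 → ∃ m : ℕ, m ≠ 0 ∧ m • c ∈ KZ.relations

/-- The import: ℚ-kernel ⇒ (torsion-freeness of `relations`, VGT item 3169) ⇒ kernel ⊆ relations ⊆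
closure GX (monotonicity of `AddSubgroup.closure`). -/
def CardI_Import : Prop := RationalMultipleKernel → XMapKernel

/-! ### Card P — `axiom-saturated-sector-peeling` -/

/-- Two integral models are JOINED if an x-rational isogeny datum goes from the first to the
second. -/
def Joined (E E' : ℤ × ℤ) : Prop := ∃ (f g : ℚ[X]) (c : ℚ), IsXDatum E.1 E.2 E'.1 E'.2 f g c

/-- The real period `Ω(E) = ∫_{P_E > 0} dx/√P_E`. -/
def realPeriod (E : ℤ × ℤ) : ℝ :=
  ∫ x in {x : ℝ | 0 < x ^ 3 + (E.1 : ℝ) * x + (E.2 : ℝ)}, 1 / Real.sqrt (x ^ 3 + (E.1 : ℝ) * x + (E.2 : ℝ))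

/-- H1′: `Joined` is an equivalence relation on nonsingular models (identity datum `(X, 1, 1)`;
dual isogeny; composition of x-maps). -/
def JoinedEquivalence : Prop :=
  (∀ E, Nonsing E → Joined E E) ∧
  (∀ E E', Nonsing E → Nonsing E' → Joined E E' → Joined E' E) ∧
  (∀ E E' E'', Nonsing E → Nonsing E' → Nonsing E'' → Joined E E' → Joined E' E'' → Joined E E'')

/-- H1 (value half of T_iso, real analysis only): along a datum the real periods have a positive
RATIONAL ratio (`|c|·Ω(E) = (m₀+m₁)/2 · Ω(E′)` by the area formula with constant multiplicities
and `∫_egg′ = ∫_unbounded′`). -/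
def RationalPeriodRatio : Prop :=
  ∀ E E', Nonsing E → Nonsing E' → Joined E E' → ∃ q : ℚ, 0 < q ∧ realPeriod E' = q * realPeriod E

/-- H2 (transcendence input, Huber–Wüstholz Thm 15.3 (1) for `[ℤ→0] × E₁ × ⋯ × E_s` plus the
twist/CM classification over ℚ): a ℚ-linear relation among real periods of integral models splits
along the `Joined`-classes. -/
def ClassSumsVanish : Prop :=
  ∀ (k : ℕ) (E : Fin k → ℤ × ℤ) (lam : Fin k → ℚ), (∀ i, Nonsing (E i)) →
    ∑ i, (lam i : ℝ) * realPeriod (E i) = 0 →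
      ∀ i, ∑ j, (if Joined (E j) (E i) then (lam j : ℝ) * realPeriod (E j) else 0) = 0

/-- The generators of the elliptic real-period sector. -/
def ellGens : Set KZ.FormalRep :=
  {x | ∃ (E : ℤ × ℤ) (a : ℚ) (r : KZ.IntegralRep 1), Nonsing E ∧ 0 < a ∧ IsEllRep E a r ∧ x = KZ.of r}

/-- SECTOR THEOREM (target of Card P's provable half): the crux restricted to the elliptic
real-period sector — with the relators as axioms, no move-level transfer is needed. -/
def EllipticSectorXMapKernel : Prop :=
  ∀ e ∈ AddSubgroup.closure ellGens, KZ.eval e = 0 → e ∈ AddSubgroup.closure GX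

/-- FIRST LEMMA (Card P). -/
def CardP_FirstLemma : Prop :=
  JoinedEquivalence → RationalPeriodRatio → ClassSumsVanish → EllipticSectorXMapKernel

/-- The declared remainder (GPC strength): the kernel conjecture modulo the elliptic sector. -/
def KernelModElliptic : Prop :=
  ∀ c : KZ.FormalRep, KZ.eval c = 0 →
    ∃ e ∈ AddSubgroup.closure ellGens, c - e ∈ KZ.relations

/-- Composition of Card P (uses soundness `KZ.relations_le_ker_eval_holds` to get `eval e = 0`). -/
def CardP_Composition : Prop := EllipticSectorXMapKernel → KernelModElliptic → XMapKernel

/-! ### Proved glue (kernel-checked claims used by both cards) -/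

/-- The crux is SUMMIT-WEAK: the plain kernel conjecture implies it (closure monotonicity). -/
theorem xMapKernel_of_kzKernelConjecture (h : KZKernelConjecture) : XMapKernel := by
  intro c hc
  exact AddSubgroup.closure_mono Set.subset_union_left (h c hc)

/-- Hence Conjecture 1 itself implies the crux (tree: `kzKernelConjecture_iff_isRational`). -/
theorem xMapKernel_of_summit (h : _root_.KontsevichZagierPeriods) : XMapKernel :=
  xMapKernel_of_kzKernelConjecture (kzKernelConjecture_iff_isRational.mpr h)

/-- The named generator set `GX` is contained in the crux's literal one (regrouped conjuncts). -/
theorem xMapKernel_of_xMapKernel' (h : XMapKernel') : XMapKernel := by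
  intro c hc
  refine AddSubgroup.closure_mono (Set.union_subset_union_right _ ?_) (h c hc)
  rintro d ⟨A, B, A', B', f, g, c, a, b, r, r', hΔ, hΔ', ⟨hW, hI⟩, ha, hb, ⟨h1, h2⟩, ⟨h3, h4⟩, h5, rfl⟩
  exact ⟨A, B, A', B', f, g, c, a, b, r, r', hΔ, hΔ', hW, hI, ha, hb, h1, h2, h3, h4, h5, rfl⟩

/-- Card I's import, PROVED from VeryGoodTransfer's support item `TorsionFree` (stmt-3169). -/
theorem cardI_import_of_torsionFree
    (hT : Summit.KontsevichZagierPeriods.KontsevichZagierPeriods.Theses.VeryGoodTransfer.TorsionFree) :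
    CardI_Import := by
  intro hQ c hc
  obtain ⟨m, hm, hmc⟩ := hQ c hc
  exact AddSubgroup.closure_mono Set.subset_union_left (hT m c hm hmc)

/-- Card P's composition, PROVED (soundness of the moves gives `eval e = 0`). -/
theorem cardP_composition : CardP_Composition := by
  intro hS hK
  apply xMapKernel_of_xMapKernel'
  intro c hc
  obtain ⟨e, he, hce⟩ := hK c hc
  have hrel : c - e ∈ AddSubgroup.closure GX :=
    AddSubgroup.closure_mono Set.subset_union_left hce
  have he0 : KZ.eval e = 0 := by
    have h1 : KZ.eval (c - e) = 0 := KZ.relations_le_ker_eval_holds hce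
    rw [map_sub, hc, zero_sub, neg_eq_zero] at h1
    exact h1
  have heX : e ∈ AddSubgroup.closure GX := hS e he he0
  simpa using AddSubgroup.add_mem _ hrel heX

/-! ### Sanity: the lemniscate datum is a datum (as in the route's calibration) -/

example : IsXDatum (-1) 0 4 0 (X ^ 2 - 1) X 1 := by
  refine ⟨?_, ?_⟩
  · intro h
    have := congrArg (fun p : ℚ[X] => p.eval 0) h
    simp at this
  · have hC : (C (2 : ℚ) : ℚ[X]) = 2 := map_ofNat C 2
    have h2 : derivative (X ^ 2 - 1 : ℚ[X]) = 2 * X := by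
      simp [one_add_one_eq_two, hC]
    rw [h2]
    simp only [map_one, one_pow, Int.cast_zero, map_zero, Int.cast_ofNat, Int.cast_neg,
      Int.cast_one, map_neg, map_ofNat, derivative_X]
    ring

end Summit.KontsevichZagierPeriods.KontsevichZagierPeriods.Cruxes.XMapKernel.Ideator1
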